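import Literature.AlgebraicTopology.SingularHomology.CohomologyMayerVietorisInjective
import HarnessLib

/-!
# Mayer–Vietoris for singular cohomology: classes on the overlap of an open cover are
# differences of restrictions when `H^{p+1}(X) = 0`

A. Hatcher, *Algebraic Topology* (2002), §3.1, pp. 203–204: for an open cover `X = A ∪ B` the
Mayer–Vietoris sequence `⋯ → Hᵖ(A) ⊕ Hᵖ(B) → Hᵖ(A ∩ B) →δ H^{p+1}(X) → ⋯` is exact; in
particular, if `H^{p+1}(X) = 0` then every class on `A ∩ B` is a difference `a| − b|` of
restrictions of classes on `A` and on `B`.  The tree proves the sequence for the cohomology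
`H^*_X(W)` of subsets computed in the cochains of `X` (`SubsetCohomologyMayerVietoris.lean`,
`subsetCochains.exists_of_mvδ_eq_zero`) and compares `H^*_X(W)` with the singular cohomology of
the subspace `↥W` naturally in `W` (`subsetCochains.homologyIsoSingularCohomology_hom_resH`,
`CohomologyMayerVietorisInjective.lean`, whose consequence at `H^{p+1}(X)` is recorded there).
This file records the consequence at `Hᵖ(A ∩ B)` for `singularCohomology` itself:

* `singularCohomology.exists_eq_map_sub_map_of_isZero` — for open `A`, `B` with `A ∪ B = X` and
  `H^{p+1}(X; R) = 0`, every class in `Hᵖ(↥(A ∩ B); R)` is `i_A^* a − i_B^* b` for classes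
  `a ∈ Hᵖ(↥A; R)`, `b ∈ Hᵖ(↥B; R)` (pull-backs along the inclusions `↥(A ∩ B) → ↥A`,
  `↥(A ∩ B) → ↥B`);
* `singularCohomology.exists_eq_map_add_map_of_retract` — the same read on a subset
  `S ⊆ A ∩ B` onto which `A ∩ B` retracts: every class on `↥S` is `j_A^* a + j_B^* b`
  (the form used for a level `S = g⁻¹(b)` of a function inside the thin slab
  `A ∩ B = g⁻¹(b − δ, b + δ)`, which retracts onto it along gradient trajectories).

Everything is proved; no named facts.

## References

* A. Hatcher, *Algebraic Topology*, CUP 2002, §3.1 pp. 203–204 (Mayer–Vietoris in cohomology).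
  [HatcherAT2002]
-/

noncomputable section

open CategoryTheory Limits Set

universe u v

namespace Literature.AlgebraicTopology.SingularHomology

namespace singularCohomology

variable (R : Type v) [CommRing R] {X : Type u} [TopologicalSpace X]

/-- **A class on the overlap of an open cover is a difference of restrictions when
`H^{p+1}(X) = 0`** (Hatcher 2002, §3.1 pp. 203–204, exactness of Mayer–Vietoris at
`Hᵖ(A ∩ B)`): for `A`, `B` open with `A ∪ B = X` and `H^{p+1}(X; R) = 0`, every
`e ∈ Hᵖ(↥(A ∩ B); R)` is `i_A^* a − i_B^* b` with `a ∈ Hᵖ(↥A; R)`, `b ∈ Hᵖ(↥B; R)`.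
[cite: HatcherAT2002, §3.1 pp. 203–204] -/
theorem exists_eq_map_sub_map_of_isZero {A B : Set X} (hA : IsOpen A) (hB : IsOpen B)
    (hAB : A ∪ B = univ) {p : ℕ} (hZ : IsZero (singularCohomology R R X (p + 1)))
    (e : singularCohomology R R (↥(A ∩ B)) p) :
    ∃ (a : singularCohomology R R (↥A) p) (b : singularCohomology R R (↥B) p),
      e = map R R (ContinuousMap.inclusion inter_subset_left) p a -
        map R R (ContinuousMap.inclusion inter_subset_right) p b := by
  -- transport `e` to `H^p_X(A ∩ B)`
  set d := (subsetCochains.homologyIsoSingularCohomology R (A ∩ B) p).inv e with hd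
  have hde : (subsetCochains.homologyIsoSingularCohomology R (A ∩ B) p).hom d = e := by
    rw [hd, ← ModuleCat.comp_apply, Iso.inv_hom_id, ModuleCat.id_apply]
  -- `H^{p+1}_X(A ∪ B) ≅ H^{p+1}(↥(A ∪ B)) ≅ H^{p+1}(X) = 0`
  let eS : ↥(A ∪ B) ≃ₜ X := (Homeomorph.setCongr hAB).trans (Homeomorph.Set.univ X)
  have hZ' : IsZero ((subsetCochains R (ModuleCat.of R (ULift.{u} R)) (A ∪ B)).homology (p + 1)) :=
    IsZero.of_iso (IsZero.of_iso hZ (mapIso R R eS (p + 1)).symm)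
      (subsetCochains.homologyIsoSingularCohomology R (A ∪ B) (p + 1))
  have h0 : subsetCochains.mvδ R (ModuleCat.of R (ULift.{u} R)) hA hB p d = 0 := by
    rw [hZ'.eq_of_tgt (subsetCochains.mvδ R (ModuleCat.of R (ULift.{u} R)) hA hB p) 0]
    rfl
  obtain ⟨a', b', hab⟩ := subsetCochains.exists_of_mvδ_eq_zero (R := R) hA hB d h0
  refine ⟨(subsetCochains.homologyIsoSingularCohomology R A p).hom a',
    (subsetCochains.homologyIsoSingularCohomology R B p).hom b', ?_⟩
  rw [← hde, hab, map_sub, subsetCochains.homologyIsoSingularCohomology_hom_resH,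
    subsetCochains.homologyIsoSingularCohomology_hom_resH]

/-- **Classes on a retract of the overlap** (Hatcher 2002, §3.1 pp. 203–204 with a retraction):
for `A`, `B` open with `A ∪ B = X`, `H^{p+1}(X; R) = 0`, and `S ⊆ A ∩ B` with a retraction
`r : ↥(A ∩ B) → ↥S` (`r ∘ incl = id`), every class `x ∈ Hᵖ(↥S; R)` is `j_A^* a + j_B^* b` with
`a ∈ Hᵖ(↥A; R)`, `b ∈ Hᵖ(↥B; R)`, `j_A : ↥S → ↥A`, `j_B : ↥S → ↥B` the inclusions: apply the
previous statement to `r^* x` and restrict back to `S`. [cite: HatcherAT2002, §3.1 pp. 203–204] -/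
theorem exists_eq_map_add_map_of_retract {A B S : Set X} (hA : IsOpen A) (hB : IsOpen B)
    (hAB : A ∪ B = univ) (hS : S ⊆ A ∩ B) (r : C(↥(A ∩ B), ↥S))
    (hr : ∀ s : ↥S, r (inclusion hS s) = s) {p : ℕ}
    (hZ : IsZero (singularCohomology R R X (p + 1))) (x : singularCohomology R R (↥S) p) :
    ∃ (a : singularCohomology R R (↥A) p) (b : singularCohomology R R (↥B) p),
      x = map R R (ContinuousMap.inclusion (hS.trans inter_subset_left)) p a +
        map R R (ContinuousMap.inclusion (hS.trans inter_subset_right)) p b := by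
  obtain ⟨a, b, hab⟩ := exists_eq_map_sub_map_of_isZero R hA hB hAB hZ (map R R r p x)
  refine ⟨a, -b, ?_⟩
  have hx : x = map R R (ContinuousMap.inclusion hS) p (map R R r p x) := by
    rw [← ModuleCat.comp_apply, ← map_comp]
    have hid : r.comp (ContinuousMap.inclusion hS) = ContinuousMap.id ↥S :=
      ContinuousMap.ext hr
    rw [hid, map_id, ModuleCat.id_apply]
  rw [hx, hab, map_sub, map_neg, sub_eq_add_neg, ← ModuleCat.comp_apply, ← ModuleCat.comp_apply,
    ← map_comp, ← map_comp]
  rfl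

end singularCohomology

end Literature.AlgebraicTopology.SingularHomology

end
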